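import Summits.ValiantsHypothesis.ValiantsHypothesis.Theorems.NewtonFramesTwoProductsFrameRungTwoShallowNeighbourCore

/-!
# Crux `TwoProducts` (stmt-5906), line `FrameRungTwo`: the cancellation kernel `hCancel` holds on the CLEAN-SPLIT regime

`hCancel` of `…ShallowNeighbourCore.lean` (p637974; Conjecture Q4′ in weight form): at a common vertex `e` whose `S`-word `a` and
`S'`-word `u` both demote ≥ 4 letters, letter weights `cf, cg` that cancel at every light common point other than `e` also cancel AT `e`.
This file proves it whenever some CORNER SPLIT of `a` is CLEAN: for a set `F` of demoted coordinates (`∅ ≠ F ⊊` demotion set) the two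
corners `b_F = (a on F, T elsewhere)` and `b_{Fᶜ}` have `S'`-words `c, c'` with DISJOINT demotion sets (`∀ j, c j = T' j ∨ c' j = T' j`).
Mechanism (`cancel_of_cleanSplit`): `c ⊔ c'` is an `S'`-word with sum `e`, hence `= u` (dissociation); the weight products multiply
over disjoint supports (`Π cf b_F · Π cf b_{Fᶜ} = Π cf a · Π cf T`, same for `cg`), and the three cancellations at `Σ b_F`, `Σ b_{Fᶜ}`
and at the top give `Π cf a = −Π cg u`.  `cancel_of_cleanSplit'` is the mirror (a clean split of `u`).  By `memo-IX-g4.md` §2 clean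
splits exist in ≈ 85 % of deep–deep pairs but NOT always (Lemma M(4,4) is false: d = 94 witness), so this is a regime, not the kernel;
the complementary proved regime (no same-coordinate representation of the top gap, §2b) is on paper only.
Honest scope: a partial discharge of ONE hypothesis of ONE stub of a rung strictly below the crux `TwoProducts`; nothing here bears on
`VP ≠ VNP`.  [ours; setting KPTT arXiv:1308.2286 §2, §5]
-/

set_option linter.dupNamespace false

namespace Summit.ValiantsHypothesis.ValiantsHypothesis.Theorems.NewtonFramesTwoProducts.FrameRungTwoTrinomial

open MvPolynomial
open scoped BigOperators Classical
open Summit.ValiantsHypothesis.Theorems.DissociatedFixedK (lexKey lexKey_injective)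
open Summit.ValiantsHypothesis.ValiantsHypothesis.Theorems.DissociatedFixedK.Negative (emb emb_injective)
open Summit.ValiantsHypothesis.ValiantsHypothesis.Theorems.NewtonFramesTwoProducts.FrameRungTwoBinomial
  (emb_add emb_sum apply_le_of_lexKey_le lexKey_sum_lt_sum)

noncomputable section

section CleanSplit

variable {m : ℕ}

/-- A partial promotion of a word towards the key-tops has a key-larger sum as soon as one demoted letter is promoted. [folklore] -/
theorem lexKey_lt_corner (lc : (Fin 2 → ℝ) →L[ℝ] ℝ) (S : Fin m → Finset (Fin 2 →₀ ℕ)) (T a b : Fin m → (Fin 2 →₀ ℕ))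
    (hTmax : ∀ j, ∀ x ∈ S j, lexKey lc x ≤ lexKey lc (T j)) (ha : ∀ j, a j ∈ S j)
    (hb : ∀ j, b j = a j ∨ b j = T j) (j₀ : Fin m) (hj₀ : a j₀ ≠ T j₀) (hbj₀ : b j₀ = T j₀) :
    lexKey lc (∑ j, a j) < lexKey lc (∑ j, b j) := by
  refine lexKey_sum_lt_sum lc a b (fun j => ?_) ⟨j₀, ?_⟩
  · rcases hb j with h | h
    · rw [h]
    · rw [h]; exact hTmax j _ (ha j)
  · rw [hbj₀]
    exact lt_of_le_of_ne (hTmax j₀ _ (ha j₀)) fun h => hj₀ (lexKey_injective lc h)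

/-- **`hCancel` on the clean-split regime (split of the `S`-word).**  Hypotheses: those of `hCancel` that are used (dissociation of
`S'`, key-tops, the two words `a`, `u` of `e`, the top data, nonvanishing of `cf` on letters, cancellation at light common points
other than `e`) plus a clean corner split `F, c, c'` of `a`.  Conclusion: the weights cancel at `e`. [ours] -/
theorem cancel_of_cleanSplit (S S' : Fin m → Finset (Fin 2 →₀ ℕ)) (lc : (Fin 2 → ℝ) →L[ℝ] ℝ) (e : Fin 2 →₀ ℕ)
    (T T' a u : Fin m → (Fin 2 →₀ ℕ)) (cf cg : Fin m → (Fin 2 →₀ ℕ) → ℂ)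
    (hS' : ∀ b c : Fin m → (Fin 2 →₀ ℕ), (∀ j, b j ∈ S' j) → (∀ j, c j ∈ S' j) → ∑ j, b j = ∑ j, c j → b = c)
    (hT : ∀ j, T j ∈ S j) (hTmax : ∀ j, ∀ x ∈ S j, lexKey lc x ≤ lexKey lc (T j)) (hT' : ∀ j, T' j ∈ S' j)
    (ha : ∀ j, a j ∈ S j) (hae : ∑ j, a j = e) (hu : ∀ j, u j ∈ S' j) (hue : ∑ j, u j = e)
    (htop : ∑ j, T j = ∑ j, T' j) (hTe : lexKey lc e < lexKey lc (∑ j, T j))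
    (hcf : ∀ j, ∀ x ∈ S j, cf j x ≠ 0)
    (hcan : ∀ b c : Fin m → (Fin 2 →₀ ℕ), (∀ j, b j ∈ S j) → (∀ j, c j ∈ S' j) → ∑ j, b j = ∑ j, c j →
      ∑ j, b j ≠ e → lc (emb e) ≤ lc (emb (∑ j, b j)) → ∏ j, cf j (b j) + ∏ j, cg j (c j) = 0)
    (F : Finset (Fin m)) (hF : ∀ j ∈ F, a j ≠ T j) (hFne : F.Nonempty) (hFlt : ∃ j, a j ≠ T j ∧ j ∉ F)
    (c c' : Fin m → (Fin 2 →₀ ℕ)) (hc : ∀ j, c j ∈ S' j) (hc' : ∀ j, c' j ∈ S' j)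
    (hcs : ∑ j, c j = ∑ j, (if j ∈ F then a j else T j))
    (hcs' : ∑ j, c' j = ∑ j, (if j ∈ F then T j else a j))
    (hclean : ∀ j, c j = T' j ∨ c' j = T' j) :
    ∏ j, cf j (a j) + ∏ j, cg j (u j) = 0 := by
  set bF : Fin m → (Fin 2 →₀ ℕ) := fun j => if j ∈ F then a j else T j with hbF
  set bG : Fin m → (Fin 2 →₀ ℕ) := fun j => if j ∈ F then T j else a j with hbG
  have hbFmem : ∀ j, bF j ∈ S j := fun j => by
    simp only [hbF]; split_ifs; exacts [ha j, hT j]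
  have hbGmem : ∀ j, bG j ∈ S j := fun j => by
    simp only [hbG]; split_ifs; exacts [hT j, ha j]
  have hbFalt : ∀ j, bF j = a j ∨ bF j = T j := fun j => by
    simp only [hbF]; split_ifs; exacts [Or.inl rfl, Or.inr rfl]
  have hbGalt : ∀ j, bG j = a j ∨ bG j = T j := fun j => by
    simp only [hbG]; split_ifs; exacts [Or.inr rfl, Or.inl rfl]
  -- the two corners and the top are key-above `e`, hence light and different from `e`
  obtain ⟨j₁, hj₁, hj₁F⟩ := hFlt
  obtain ⟨j₂, hj₂F⟩ := hFne
  have hkF : lexKey lc e < lexKey lc (∑ j, bF j) := by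
    rw [← hae]
    exact lexKey_lt_corner lc S T a bF hTmax ha hbFalt j₁ hj₁ (by simp only [hbF, if_neg hj₁F])
  have hkG : lexKey lc e < lexKey lc (∑ j, bG j) := by
    rw [← hae]
    exact lexKey_lt_corner lc S T a bG hTmax ha hbGalt j₂ (hF j₂ hj₂F) (by simp only [hbG, if_pos hj₂F])
  have hneF : ∑ j, bF j ≠ e := fun h => by rw [h] at hkF; exact lt_irrefl _ hkF
  have hneG : ∑ j, bG j ≠ e := fun h => by rw [h] at hkG; exact lt_irrefl _ hkG
  have hneT : ∑ j, T j ≠ e := fun h => by rw [h] at hTe; exact lt_irrefl _ hTe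
  -- the three cancellations
  have hPF : ∏ j, cf j (bF j) + ∏ j, cg j (c j) = 0 :=
    hcan bF c hbFmem hc (by rw [hcs]) hneF (apply_le_of_lexKey_le lc hkF.le)
  have hPG : ∏ j, cf j (bG j) + ∏ j, cg j (c' j) = 0 :=
    hcan bG c' hbGmem hc' (by rw [hcs']) hneG (apply_le_of_lexKey_le lc hkG.le)
  have hPT : ∏ j, cf j (T j) + ∏ j, cg j (T' j) = 0 :=
    hcan T T' hT hT' htop hneT (apply_le_of_lexKey_le lc hTe.le)
  -- the merged word c ⊔ c' is an S'-word with sum e, hence u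
  set cs : Fin m → (Fin 2 →₀ ℕ) := fun j => if c j = T' j then c' j else c j with hcsdef
  have hcsmem : ∀ j, cs j ∈ S' j := fun j => by
    simp only [hcsdef]; split_ifs; exacts [hc' j, hc j]
  have hpt : ∀ j, cs j + T' j = c j + c' j := fun j => by
    simp only [hcsdef]
    split_ifs with h
    · rw [h, add_comm]
    · rcases hclean j with h' | h'
      · exact absurd h' h
      · rw [h']
  have hptF : ∀ j, bF j + bG j = a j + T j := fun j => by
    simp only [hbF, hbG]; split_ifs <;> [rfl; exact add_comm _ _]
  have hsumcs : ∑ j, cs j + ∑ j, T' j = e + ∑ j, T' j := by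
    rw [← Finset.sum_add_distrib, Finset.sum_congr rfl fun j _ => hpt j, Finset.sum_add_distrib, hcs, hcs',
      ← Finset.sum_add_distrib, Finset.sum_congr rfl fun j _ => hptF j, Finset.sum_add_distrib, hae, htop]
  have hsume : ∑ j, cs j = e := add_right_cancel hsumcs
  have hcsu : cs = u := hS' cs u hcsmem hu (by rw [hsume, hue])
  -- weight products multiply over the disjoint supports
  have hprodg : (∏ j, cg j (cs j)) * ∏ j, cg j (T' j) = (∏ j, cg j (c j)) * ∏ j, cg j (c' j) := by
    rw [← Finset.prod_mul_distrib, ← Finset.prod_mul_distrib]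
    refine Finset.prod_congr rfl fun j _ => ?_
    simp only [hcsdef]
    split_ifs with h
    · rw [h, mul_comm]
    · rcases hclean j with h' | h'
      · exact absurd h' h
      · rw [h']
  have hprodf : (∏ j, cf j (bF j)) * ∏ j, cf j (bG j) = (∏ j, cf j (a j)) * ∏ j, cf j (T j) := by
    rw [← Finset.prod_mul_distrib, ← Finset.prod_mul_distrib]
    refine Finset.prod_congr rfl fun j _ => ?_
    simp only [hbF, hbG]; split_ifs <;> [rfl; exact mul_comm _ _]
  rw [hcsu] at hprodg
  have hT0 : ∏ j, cf j (T j) ≠ 0 := Finset.prod_ne_zero_iff.2 fun j _ => hcf j _ (hT j)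
  -- algebra
  have h1 : ∏ j, cf j (bF j) = -∏ j, cg j (c j) := eq_neg_of_add_eq_zero_left hPF
  have h2 : ∏ j, cf j (bG j) = -∏ j, cg j (c' j) := eq_neg_of_add_eq_zero_left hPG
  have h3 : ∏ j, cg j (T' j) = -∏ j, cf j (T j) := eq_neg_of_add_eq_zero_right hPT
  have h4 : ((∏ j, cf j (a j)) + ∏ j, cg j (u j)) * ∏ j, cf j (T j) = 0 := by
    have : (∏ j, cf j (a j)) * ∏ j, cf j (T j) = -((∏ j, cg j (u j)) * ∏ j, cf j (T j)) := by
      rw [← hprodf, h1, h2, neg_mul_neg, ← hprodg, h3]; ring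
    rw [add_mul, this]; ring
  rcases mul_eq_zero.1 h4 with h | h
  · exact h
  · exact absurd h hT0

/-- **`hCancel` on the clean-split regime (split of the `S'`-word).**  The mirror statement: a clean corner split of `u` (the two
corners of `u` have `S`-words with disjoint demotion sets) also forces cancellation at `e`. [ours] -/
theorem cancel_of_cleanSplit' (S S' : Fin m → Finset (Fin 2 →₀ ℕ)) (lc : (Fin 2 → ℝ) →L[ℝ] ℝ) (e : Fin 2 →₀ ℕ)
    (T T' a u : Fin m → (Fin 2 →₀ ℕ)) (cf cg : Fin m → (Fin 2 →₀ ℕ) → ℂ)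
    (hS : ∀ b c : Fin m → (Fin 2 →₀ ℕ), (∀ j, b j ∈ S j) → (∀ j, c j ∈ S j) → ∑ j, b j = ∑ j, c j → b = c)
    (hT : ∀ j, T j ∈ S j) (hT' : ∀ j, T' j ∈ S' j) (hTmax' : ∀ j, ∀ x ∈ S' j, lexKey lc x ≤ lexKey lc (T' j))
    (ha : ∀ j, a j ∈ S j) (hae : ∑ j, a j = e) (hu : ∀ j, u j ∈ S' j) (hue : ∑ j, u j = e)
    (htop : ∑ j, T j = ∑ j, T' j) (hTe : lexKey lc e < lexKey lc (∑ j, T j))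
    (hcg : ∀ j, ∀ x ∈ S' j, cg j x ≠ 0)
    (hcan : ∀ b c : Fin m → (Fin 2 →₀ ℕ), (∀ j, b j ∈ S j) → (∀ j, c j ∈ S' j) → ∑ j, b j = ∑ j, c j →
      ∑ j, b j ≠ e → lc (emb e) ≤ lc (emb (∑ j, b j)) → ∏ j, cf j (b j) + ∏ j, cg j (c j) = 0)
    (F : Finset (Fin m)) (hF : ∀ j ∈ F, u j ≠ T' j) (hFne : F.Nonempty) (hFlt : ∃ j, u j ≠ T' j ∧ j ∉ F)
    (b b' : Fin m → (Fin 2 →₀ ℕ)) (hb : ∀ j, b j ∈ S j) (hb' : ∀ j, b' j ∈ S j)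
    (hbs : ∑ j, b j = ∑ j, (if j ∈ F then u j else T' j))
    (hbs' : ∑ j, b' j = ∑ j, (if j ∈ F then T' j else u j))
    (hclean : ∀ j, b j = T j ∨ b' j = T j) :
    ∏ j, cf j (a j) + ∏ j, cg j (u j) = 0 := by
  have hcan' : ∀ c b : Fin m → (Fin 2 →₀ ℕ), (∀ j, c j ∈ S' j) → (∀ j, b j ∈ S j) → ∑ j, c j = ∑ j, b j →
      ∑ j, c j ≠ e → lc (emb e) ≤ lc (emb (∑ j, c j)) → ∏ j, cg j (c j) + ∏ j, cf j (b j) = 0 := by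
    intro c b hc hb hcb hne hle
    rw [add_comm]
    exact hcan b c hb hc hcb.symm (by rw [← hcb]; exact hne) (by rw [← hcb]; exact hle)
  have h := cancel_of_cleanSplit S' S lc e T' T u a cg cf hS hT' hTmax' hT hu hue ha hae htop.symm
    (by rw [← htop]; exact hTe) hcg hcan' F hF hFne hFlt b b' hb hb' hbs hbs' hclean
  rwa [add_comm] at h

/-- Letter-weight products of two COMPLEMENTARY corners of a word multiply to (word) × (top). [folklore] -/
theorem prod_corner_mul_prod_corner (F : Finset (Fin m)) (T a : Fin m → (Fin 2 →₀ ℕ)) (cf : Fin m → (Fin 2 →₀ ℕ) → ℂ) :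
    (∏ j, cf j (if j ∈ F then a j else T j)) * ∏ j, cf j (if j ∈ F then T j else a j) =
      (∏ j, cf j (a j)) * ∏ j, cf j (T j) := by
  rw [← Finset.prod_mul_distrib, ← Finset.prod_mul_distrib]
  refine Finset.prod_congr rfl fun j _ => ?_
  split_ifs <;> [rfl; exact mul_comm _ _]

/-- Sums of two complementary corners of a word add up to (word) + (top). [folklore] -/
theorem sum_corner_add_sum_corner (F : Finset (Fin m)) (T a : Fin m → (Fin 2 →₀ ℕ)) :
    (∑ j, (if j ∈ F then a j else T j)) + ∑ j, (if j ∈ F then T j else a j) = (∑ j, a j) + ∑ j, T j := by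
  rw [← Finset.sum_add_distrib, ← Finset.sum_add_distrib]
  refine Finset.sum_congr rfl fun j _ => ?_
  split_ifs <;> [rfl; exact add_comm _ _]

/-- **`hCancel` on the LINK regime** (generalises the clean-split regime; no dissociation needed).  If some proper corner of the
`S`-word `a` of `e` (coordinates `F`: at least one demoted letter kept, at least one promoted) has the SAME SUM as some corner of the
`S'`-word `u` (coordinates `E`, arbitrary) — a "0-step link" of `memo-IX-robust.md` §2 / `memo-IX-g4.md` — then letter weights that
cancel at the light common points other than `e` cancel at `e`: the two corners form a common point, so do their complements
(sums add up to `e + top` on both sides), and the four products multiply to `Π cf a · Π cf T = Π cg u · Π cg T'`.  A clean split is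
the special case where the `S'`-word of the corner is itself a corner of `u`.  In the data of memo-IX-g4 §2b a 0-step link exists in
≈ 95 % of deep–deep pairs (not always: interval-type windows). [ours] -/
theorem cancel_of_link (S S' : Fin m → Finset (Fin 2 →₀ ℕ)) (lc : (Fin 2 → ℝ) →L[ℝ] ℝ) (e : Fin 2 →₀ ℕ)
    (T T' a u : Fin m → (Fin 2 →₀ ℕ)) (cf cg : Fin m → (Fin 2 →₀ ℕ) → ℂ)
    (hT : ∀ j, T j ∈ S j) (hTmax : ∀ j, ∀ x ∈ S j, lexKey lc x ≤ lexKey lc (T j)) (hT' : ∀ j, T' j ∈ S' j)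
    (ha : ∀ j, a j ∈ S j) (hae : ∑ j, a j = e) (hu : ∀ j, u j ∈ S' j) (hue : ∑ j, u j = e)
    (htop : ∑ j, T j = ∑ j, T' j) (hTe : lexKey lc e < lexKey lc (∑ j, T j))
    (hcf : ∀ j, ∀ x ∈ S j, cf j x ≠ 0)
    (hcan : ∀ b c : Fin m → (Fin 2 →₀ ℕ), (∀ j, b j ∈ S j) → (∀ j, c j ∈ S' j) → ∑ j, b j = ∑ j, c j →
      ∑ j, b j ≠ e → lc (emb e) ≤ lc (emb (∑ j, b j)) → ∏ j, cf j (b j) + ∏ j, cg j (c j) = 0)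
    (F : Finset (Fin m)) (hF1 : ∃ j ∈ F, a j ≠ T j) (hF2 : ∃ j, a j ≠ T j ∧ j ∉ F) (E : Finset (Fin m))
    (hlink : ∑ j, (if j ∈ F then a j else T j) = ∑ j, (if j ∈ E then u j else T' j)) :
    ∏ j, cf j (a j) + ∏ j, cg j (u j) = 0 := by
  set bF : Fin m → (Fin 2 →₀ ℕ) := fun j => if j ∈ F then a j else T j with hbF
  set bG : Fin m → (Fin 2 →₀ ℕ) := fun j => if j ∈ F then T j else a j with hbG
  set cE : Fin m → (Fin 2 →₀ ℕ) := fun j => if j ∈ E then u j else T' j with hcE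
  set cH : Fin m → (Fin 2 →₀ ℕ) := fun j => if j ∈ E then T' j else u j with hcH
  have hbFmem : ∀ j, bF j ∈ S j := fun j => by simp only [hbF]; split_ifs; exacts [ha j, hT j]
  have hbGmem : ∀ j, bG j ∈ S j := fun j => by simp only [hbG]; split_ifs; exacts [hT j, ha j]
  have hcEmem : ∀ j, cE j ∈ S' j := fun j => by simp only [hcE]; split_ifs; exacts [hu j, hT' j]
  have hcHmem : ∀ j, cH j ∈ S' j := fun j => by simp only [hcH]; split_ifs; exacts [hT' j, hu j]
  have hbFalt : ∀ j, bF j = a j ∨ bF j = T j := fun j => by simp only [hbF]; split_ifs; exacts [Or.inl rfl, Or.inr rfl]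
  have hbGalt : ∀ j, bG j = a j ∨ bG j = T j := fun j => by simp only [hbG]; split_ifs; exacts [Or.inr rfl, Or.inl rfl]
  obtain ⟨j₁, hj₁, hj₁F⟩ := hF2
  obtain ⟨j₂, hj₂F, hj₂⟩ := hF1
  have hkF : lexKey lc e < lexKey lc (∑ j, bF j) := by
    rw [← hae]; exact lexKey_lt_corner lc S T a bF hTmax ha hbFalt j₁ hj₁ (by simp only [hbF, if_neg hj₁F])
  have hkG : lexKey lc e < lexKey lc (∑ j, bG j) := by
    rw [← hae]; exact lexKey_lt_corner lc S T a bG hTmax ha hbGalt j₂ hj₂ (by simp only [hbG, if_pos hj₂F])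
  have hneF : ∑ j, bF j ≠ e := fun h => by rw [h] at hkF; exact lt_irrefl _ hkF
  have hneG : ∑ j, bG j ≠ e := fun h => by rw [h] at hkG; exact lt_irrefl _ hkG
  have hneT : ∑ j, T j ≠ e := fun h => by rw [h] at hTe; exact lt_irrefl _ hTe
  -- the complements are linked too
  have hsF : (∑ j, bF j) + ∑ j, bG j = e + ∑ j, T j := by rw [sum_corner_add_sum_corner F T a, hae]
  have hsE : (∑ j, cE j) + ∑ j, cH j = e + ∑ j, T j := by rw [sum_corner_add_sum_corner E T' u, hue, htop]
  have hlink' : ∑ j, bG j = ∑ j, cH j := by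
    have h : (∑ j, bF j) + ∑ j, bG j = (∑ j, bF j) + ∑ j, cH j := by rw [hsF, ← hsE, ← hlink]
    exact add_left_cancel h
  -- the three cancellations
  have hPF : ∏ j, cf j (bF j) + ∏ j, cg j (cE j) = 0 :=
    hcan bF cE hbFmem hcEmem hlink hneF (apply_le_of_lexKey_le lc hkF.le)
  have hPG : ∏ j, cf j (bG j) + ∏ j, cg j (cH j) = 0 :=
    hcan bG cH hbGmem hcHmem hlink' hneG (apply_le_of_lexKey_le lc hkG.le)
  have hPT : ∏ j, cf j (T j) + ∏ j, cg j (T' j) = 0 :=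
    hcan T T' hT hT' htop hneT (apply_le_of_lexKey_le lc hTe.le)
  have hprodf := prod_corner_mul_prod_corner F T a cf
  have hprodg := prod_corner_mul_prod_corner E T' u cg
  have hT0 : ∏ j, cf j (T j) ≠ 0 := Finset.prod_ne_zero_iff.2 fun j _ => hcf j _ (hT j)
  have h1 : ∏ j, cf j (bF j) = -∏ j, cg j (cE j) := eq_neg_of_add_eq_zero_left hPF
  have h2 : ∏ j, cf j (bG j) = -∏ j, cg j (cH j) := eq_neg_of_add_eq_zero_left hPG
  have h3 : ∏ j, cg j (T' j) = -∏ j, cf j (T j) := eq_neg_of_add_eq_zero_right hPT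
  have h4 : ((∏ j, cf j (a j)) + ∏ j, cg j (u j)) * ∏ j, cf j (T j) = 0 := by
    have : (∏ j, cf j (a j)) * ∏ j, cf j (T j) = -((∏ j, cg j (u j)) * ∏ j, cf j (T j)) := by
      rw [← hprodf]
      change (∏ j, cf j (bF j)) * ∏ j, cf j (bG j) = _
      rw [h1, h2, neg_mul_neg]
      change (∏ j, cg j (if j ∈ E then u j else T' j)) * ∏ j, cg j (if j ∈ E then T' j else u j) = _
      rw [hprodg, h3]; ring
    rw [add_mul, this]; ring
  rcases mul_eq_zero.1 h4 with h | h
  · exact h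
  · exact absurd h hT0

end CleanSplit

end

end Summit.ValiantsHypothesis.ValiantsHypothesis.Theorems.NewtonFramesTwoProducts.FrameRungTwoTrinomial
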